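import Mathlib

/-!
# Route BarrierLever — item `PartitionMinorsHitByVP` (stmt-ValiantsHypothesis-19717), line `hidden_states`:
# THE EQUAL-LINK CUT OF THE FULL JOIN — an exclusively tied state factors the full hidden sum into deletion × link

Helper file (`--supports stmt-ValiantsHypothesis-19717`; cell valiant-natproofs, rung V4, 𝒟-side door (c), line
`Cruxes/PartitionMinorsHitByVP/Lines/hidden_states.lean` v8; prover seat val-np-p3 gen 16). Definition-free, `import Mathlib` only
(pure matrix algebra; the full-join matrix of `…HiddenStatesFullJoin` is written out with an explicit STATE SET `S ⊆ Fin K`, the node being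
the case `S = univ`). Closes NO item.

THE POINT (memo val-np-p3 g16 «full join» §4.3(a), §8(b)). The first INDUCTIVE tool for conjecture FJ. Fix a state `k ∉ S'`, an
`x`-coordinate `a` and a `y`-coordinate `b`, and tie them EXCLUSIVELY to `k`: `tx none a = 0`, `tx (some k) a = 1`, `tx (some q) a = 0`
(`q ≠ k`), `tx (some k) a' = 0` (`a' ≠ a`), and the same for `ty` at `b`. Then every entry of the full hidden sum over the state set
`insert k S'` factors (`fullJoin_entry_cut`):
`M[U, W] = ([a ∉ U][b ∉ W] + λ_k) · X[U ∖ a, W ∖ b]`, `X` = the full hidden sum over `S'`.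
Consequently, if the rows split as deletion `D = {i : a ∉ u i}` ⊔ link `L = {i : a ∈ u i}` and the columns as `D' ⊔ L'` with
`|D| = |D'|`, `|L| = |L'|` (EQUAL LINK SIZES), and every link row has its deletion partner (`u (eD (π ℓ)) = u (eL ℓ) ∖ a` — automatic
for a lower family), the reindexed matrix is `fromBlocks ((1+λ_k)X₁) (λ_k X₂) (λ_k X₁∘π) (λ_k X₂∘π)` and
`(1+λ_k)^{|L|} · det M = ± λ_k^{|L|} (1+λ_k)^{|D|} · det X[D, D'] · det X[L, L']` (`det_fullJoin_cut`); in particular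
(`det_fullJoin_cut_ne_zero`) `det X[D,D'] ≠ 0`, `det X[L,L'] ≠ 0`, `λ_k ≠ 0`, `1 + λ_k ≠ 0` ⇒ `det M ≠ 0` — FJ for `(u, w)` with one
more state from FJ for (deletion, deletion') and (link, link') at the SAME table. Only the `u`-side needs link ⊆ deletion; `w` need not be
lower. When `|L| ≠ |L'|` the same specialisation is identically singular (memo §4.3), so this is a tool for equal-link steps only
(PEEL⁺ pairs: 100 % / 85 % / 76 % of lower class pairs at h = 3 / 4 / 5 are reachable by such steps plus star leaves).

WHAT THIS IS NOT: an algebraic identity about one cut; no pair is certified here; item 19717 stays OPEN; nothing on crux 14610 or VP ≠ VNP.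
-/

set_option linter.dupNamespace false

namespace Summit.ValiantsHypothesis.ValiantsHypothesis.Theorems.BarrierLever.HiddenStates

open Finset Matrix

noncomputable section

namespace FullJoin

variable {h K : ℕ}

/-- The `x`-factor of a full-join entry: `F(U, J) = ∏_{a ∈ U} (tx none a + Σ_{q ∈ J} tx (some q) a)`. If coordinate `a ∈ U` hears only
state `k` and `k ∉ J`, the factor at `a` vanishes. -/
theorem xFactor_eq_zero_of_mem (tx : Option (Fin K) → Fin h → ℂ) (a : Fin h) (k : Fin K)
    (hxa0 : tx none a = 0) (hxq : ∀ q, q ≠ k → tx (some q) a = 0)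
    (U : Finset (Fin h)) (haU : a ∈ U) (J : Finset (Fin K)) (hkJ : k ∉ J) :
    (∏ a' ∈ U, (tx none a' + ∑ q ∈ J, tx (some q) a')) = 0 := by
  apply Finset.prod_eq_zero haU
  rw [hxa0, zero_add]
  exact Finset.sum_eq_zero fun q hq => hxq q (fun hqk => hkJ (hqk ▸ hq))

/-- Adding the exclusively tied state `k` to `J` replaces the factor at `a` by `1` and leaves the other factors unchanged:
`F(U, insert k J) = F(U ∖ a, J)`. -/
theorem xFactor_insert (tx : Option (Fin K) → Fin h → ℂ) (a : Fin h) (k : Fin K)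
    (hxa0 : tx none a = 0) (hxk : tx (some k) a = 1) (hxq : ∀ q, q ≠ k → tx (some q) a = 0)
    (hxk' : ∀ a', a' ≠ a → tx (some k) a' = 0)
    (U : Finset (Fin h)) (J : Finset (Fin K)) (hkJ : k ∉ J) :
    (∏ a' ∈ U, (tx none a' + ∑ q ∈ insert k J, tx (some q) a')) =
      ∏ a' ∈ U.erase a, (tx none a' + ∑ q ∈ J, tx (some q) a') := by
  classical
  have hother : ∀ a' ∈ U.erase a, (tx none a' + ∑ q ∈ insert k J, tx (some q) a') =
      (tx none a' + ∑ q ∈ J, tx (some q) a') := by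
    intro a' ha'
    rw [Finset.sum_insert hkJ, hxk' a' (Finset.ne_of_mem_erase ha'), zero_add]
  by_cases haU : a ∈ U
  · rw [← Finset.mul_prod_erase U _ haU, Finset.prod_congr rfl hother]
    have hfa : (tx none a + ∑ q ∈ insert k J, tx (some q) a) = 1 := by
      rw [Finset.sum_insert hkJ, hxa0, hxk, zero_add]
      rw [Finset.sum_eq_zero fun q hq => hxq q (fun hqk => hkJ (hqk ▸ hq)), add_zero]
    rw [hfa, one_mul]
  · rw [Finset.erase_eq_of_notMem haU] at hother ⊢
    exact Finset.prod_congr rfl hother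

/-- **The entry factorisation.** With the state `k ∉ S'` tied exclusively to the `x`-coordinate `a` and the `y`-coordinate `b`, every entry
of the full hidden sum over `insert k S'` is `([a ∉ U][b ∉ W] + λ_k)` times the entry of the full hidden sum over `S'` at `(U ∖ a, W ∖ b)`. -/
theorem fullJoin_entry_cut (S' : Finset (Fin K)) (k : Fin K) (hk : k ∉ S') (a b : Fin h)
    (tx ty : Option (Fin K) → Fin h → ℂ) (lam : Fin K → ℂ)
    (hxa0 : tx none a = 0) (hxk : tx (some k) a = 1) (hxq : ∀ q, q ≠ k → tx (some q) a = 0)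
    (hxk' : ∀ a', a' ≠ a → tx (some k) a' = 0)
    (hyb0 : ty none b = 0) (hyk : ty (some k) b = 1) (hyq : ∀ q, q ≠ k → ty (some q) b = 0)
    (hyk' : ∀ b', b' ≠ b → ty (some k) b' = 0)
    (U W : Finset (Fin h)) :
    (∑ J ∈ (insert k S').powerset, (∏ q ∈ J, lam q) *
        ((∏ a' ∈ U, (tx none a' + ∑ q ∈ J, tx (some q) a')) * ∏ c ∈ W, (ty none c + ∑ q ∈ J, ty (some q) c))) =
      ((if a ∉ U ∧ b ∉ W then (1 : ℂ) else 0) + lam k) *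
        ∑ J ∈ S'.powerset, (∏ q ∈ J, lam q) *
          ((∏ a' ∈ U.erase a, (tx none a' + ∑ q ∈ J, tx (some q) a')) *
            ∏ c ∈ W.erase b, (ty none c + ∑ q ∈ J, ty (some q) c)) := by
  classical
  rw [Finset.sum_powerset_insert hk]
  -- the `J ⊆ S'` part: zero unless `a ∉ U` and `b ∉ W`, in which case it is the `S'`-sum itself
  have hkJ : ∀ J ∈ S'.powerset, k ∉ J := fun J hJ hkJ => hk (Finset.mem_powerset.mp hJ hkJ)
  have h1 : (∑ J ∈ S'.powerset, (∏ q ∈ J, lam q) *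
        ((∏ a' ∈ U, (tx none a' + ∑ q ∈ J, tx (some q) a')) * ∏ c ∈ W, (ty none c + ∑ q ∈ J, ty (some q) c))) =
      (if a ∉ U ∧ b ∉ W then (1 : ℂ) else 0) *
        ∑ J ∈ S'.powerset, (∏ q ∈ J, lam q) *
          ((∏ a' ∈ U.erase a, (tx none a' + ∑ q ∈ J, tx (some q) a')) *
            ∏ c ∈ W.erase b, (ty none c + ∑ q ∈ J, ty (some q) c)) := by
    split_ifs with hab
    · rw [one_mul, Finset.erase_eq_of_notMem hab.1, Finset.erase_eq_of_notMem hab.2]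
    · rw [zero_mul]
      refine Finset.sum_eq_zero fun J hJ => ?_
      rw [not_and_or, not_not, not_not] at hab
      rcases hab with haU | hbW
      · rw [xFactor_eq_zero_of_mem tx a k hxa0 hxq U haU J (hkJ J hJ), zero_mul, mul_zero]
      · rw [xFactor_eq_zero_of_mem ty b k hyb0 hyq W hbW J (hkJ J hJ), mul_zero, mul_zero]
  -- the `insert k J` part: `λ_k` times the `S'`-sum at the erased sets
  have h2 : (∑ J ∈ S'.powerset, (∏ q ∈ insert k J, lam q) *
        ((∏ a' ∈ U, (tx none a' + ∑ q ∈ insert k J, tx (some q) a')) *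
          ∏ c ∈ W, (ty none c + ∑ q ∈ insert k J, ty (some q) c))) =
      lam k * ∑ J ∈ S'.powerset, (∏ q ∈ J, lam q) *
          ((∏ a' ∈ U.erase a, (tx none a' + ∑ q ∈ J, tx (some q) a')) *
            ∏ c ∈ W.erase b, (ty none c + ∑ q ∈ J, ty (some q) c)) := by
    rw [Finset.mul_sum]
    refine Finset.sum_congr rfl fun J hJ => ?_
    rw [Finset.prod_insert (hkJ J hJ), xFactor_insert tx a k hxa0 hxk hxq hxk' U J (hkJ J hJ),
      xFactor_insert ty b k hyb0 hyk hyq hyk' W J (hkJ J hJ)]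
    ring
  rw [h1, h2, add_mul]

variable {r rD rL : ℕ}

/-- **THE EQUAL-LINK CUT (block form).** Under the exclusivity hypotheses of `fullJoin_entry_cut`, split the rows of `(u, w)` by an
equivalence `eRow : Fin rD ⊕ Fin rL ≃ Fin r` into deletion rows (`a ∉ u`) and link rows (`a ∈ u`), the columns likewise by `eCol` at `b`
(so deletion and link have the SAME sizes `rD`, `rL` on both sides), and let `π` send each link row to the deletion row carrying `u ∖ a`.
Then the reindexed full hidden sum over `insert k S'` is the block matrix
`fromBlocks ((1+λ_k)•X₁) (λ_k•X₂) (λ_k•X₁∘π) (λ_k•X₂∘π)` with `X₁ = X[D, D']`, `X₂ = X[D, L' ∖ b]` (full hidden sums over `S'`). -/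
theorem fullJoin_submatrix_cut (S' : Finset (Fin K)) (k : Fin K) (hk : k ∉ S') (a b : Fin h)
    (u w : Fin r → Finset (Fin h)) (tx ty : Option (Fin K) → Fin h → ℂ) (lam : Fin K → ℂ)
    (hxa0 : tx none a = 0) (hxk : tx (some k) a = 1) (hxq : ∀ q, q ≠ k → tx (some q) a = 0)
    (hxk' : ∀ a', a' ≠ a → tx (some k) a' = 0)
    (hyb0 : ty none b = 0) (hyk : ty (some k) b = 1) (hyq : ∀ q, q ≠ k → ty (some q) b = 0)
    (hyk' : ∀ b', b' ≠ b → ty (some k) b' = 0)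
    (eRow eCol : Fin rD ⊕ Fin rL ≃ Fin r)
    (hDrow : ∀ i, a ∉ u (eRow (Sum.inl i))) (hLrow : ∀ ℓ, a ∈ u (eRow (Sum.inr ℓ)))
    (hDcol : ∀ j, b ∉ w (eCol (Sum.inl j))) (hLcol : ∀ ℓ, b ∈ w (eCol (Sum.inr ℓ)))
    (π : Fin rL → Fin rD) (hπ : ∀ ℓ, u (eRow (Sum.inl (π ℓ))) = (u (eRow (Sum.inr ℓ))).erase a) :
    (Matrix.of fun i j : Fin r => ∑ J ∈ (insert k S').powerset, (∏ q ∈ J, lam q) *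
        ((∏ a' ∈ u i, (tx none a' + ∑ q ∈ J, tx (some q) a')) *
          ∏ c ∈ w j, (ty none c + ∑ q ∈ J, ty (some q) c))).submatrix eRow eCol =
      Matrix.fromBlocks
        ((1 + lam k) • Matrix.of fun i j : Fin rD => ∑ J ∈ S'.powerset, (∏ q ∈ J, lam q) *
          ((∏ a' ∈ u (eRow (Sum.inl i)), (tx none a' + ∑ q ∈ J, tx (some q) a')) *
            ∏ c ∈ w (eCol (Sum.inl j)), (ty none c + ∑ q ∈ J, ty (some q) c)))
        (lam k • Matrix.of fun (i : Fin rD) (j : Fin rL) => ∑ J ∈ S'.powerset, (∏ q ∈ J, lam q) *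
          ((∏ a' ∈ u (eRow (Sum.inl i)), (tx none a' + ∑ q ∈ J, tx (some q) a')) *
            ∏ c ∈ (w (eCol (Sum.inr j))).erase b, (ty none c + ∑ q ∈ J, ty (some q) c)))
        (lam k • (Matrix.of fun i j : Fin rD => ∑ J ∈ S'.powerset, (∏ q ∈ J, lam q) *
          ((∏ a' ∈ u (eRow (Sum.inl i)), (tx none a' + ∑ q ∈ J, tx (some q) a')) *
            ∏ c ∈ w (eCol (Sum.inl j)), (ty none c + ∑ q ∈ J, ty (some q) c))).submatrix π id)
        (lam k • (Matrix.of fun (i : Fin rD) (j : Fin rL) => ∑ J ∈ S'.powerset, (∏ q ∈ J, lam q) *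
          ((∏ a' ∈ u (eRow (Sum.inl i)), (tx none a' + ∑ q ∈ J, tx (some q) a')) *
            ∏ c ∈ (w (eCol (Sum.inr j))).erase b, (ty none c + ∑ q ∈ J, ty (some q) c))).submatrix π id) := by
  classical
  refine Matrix.ext fun x y => ?_
  rcases x with i | ℓ <;> rcases y with j | ℓ'
  · -- deletion × deletion
    rw [Matrix.submatrix_apply, Matrix.of_apply, Matrix.fromBlocks_apply₁₁, Matrix.smul_apply, Matrix.of_apply,
      fullJoin_entry_cut S' k hk a b tx ty lam hxa0 hxk hxq hxk' hyb0 hyk hyq hyk',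
      if_pos ⟨hDrow i, hDcol j⟩, Finset.erase_eq_of_notMem (hDrow i), Finset.erase_eq_of_notMem (hDcol j), smul_eq_mul]
  · -- deletion × link
    rw [Matrix.submatrix_apply, Matrix.of_apply, Matrix.fromBlocks_apply₁₂, Matrix.smul_apply, Matrix.of_apply,
      fullJoin_entry_cut S' k hk a b tx ty lam hxa0 hxk hxq hxk' hyb0 hyk hyq hyk',
      if_neg (fun hh => hh.2 (hLcol ℓ')), Finset.erase_eq_of_notMem (hDrow i), zero_add, smul_eq_mul]
  · -- link × deletion
    rw [Matrix.submatrix_apply, Matrix.of_apply, Matrix.fromBlocks_apply₂₁, Matrix.smul_apply, Matrix.submatrix_apply,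
      Matrix.of_apply, fullJoin_entry_cut S' k hk a b tx ty lam hxa0 hxk hxq hxk' hyb0 hyk hyq hyk',
      if_neg (fun hh => hh.1 (hLrow ℓ)), ← hπ ℓ, Finset.erase_eq_of_notMem (hDcol j), zero_add, smul_eq_mul]
    rfl
  · -- link × link
    rw [Matrix.submatrix_apply, Matrix.of_apply, Matrix.fromBlocks_apply₂₂, Matrix.smul_apply, Matrix.submatrix_apply,
      Matrix.of_apply, fullJoin_entry_cut S' k hk a b tx ty lam hxa0 hxk hxq hxk' hyb0 hyk hyq hyk',
      if_neg (fun hh => hh.1 (hLrow ℓ)), ← hπ ℓ, zero_add, smul_eq_mul]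
    rfl

/-- Block algebra: `det (fromBlocks ((1+λ)•X₁) (λ•X₂) (λ•X₁∘π) (λ•X₂∘π)) · (1+λ)^{rL} = λ^{rL} · (1+λ)^{rD} · det X₁ · det (X₂∘π)`
(row-scale the link rows by `λ`, then clear the lower-left block with the deletion rows: no division needed). -/
theorem det_fromBlocks_cut (c : ℂ) (X₁ : Matrix (Fin rD) (Fin rD) ℂ) (X₂ : Matrix (Fin rD) (Fin rL) ℂ) (π : Fin rL → Fin rD) :
    (1 + c) ^ rL * (Matrix.fromBlocks ((1 + c) • X₁) (c • X₂) (c • X₁.submatrix π id) (c • X₂.submatrix π id)).det =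
      c ^ rL * (1 + c) ^ rD * X₁.det * (X₂.submatrix π id).det := by
  classical
  -- the selection matrix `P[ℓ, i] = [i = π ℓ]`
  set P : Matrix (Fin rL) (Fin rD) ℂ := Matrix.of fun ℓ i => if i = π ℓ then 1 else 0 with hP
  have hPX : ∀ {n : ℕ} (Y : Matrix (Fin rD) (Fin n) ℂ), P * Y = Y.submatrix π id := by
    intro n Y
    ext ℓ j
    simp [hP, Matrix.mul_apply, Matrix.submatrix_apply]
  -- M = diag(1, c) · N with N = fromBlocks ((1+c)X₁) (cX₂) (PX₁) (PX₂)
  set N : Matrix (Fin rD ⊕ Fin rL) (Fin rD ⊕ Fin rL) ℂ :=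
    Matrix.fromBlocks ((1 + c) • X₁) (c • X₂) (X₁.submatrix π id) (X₂.submatrix π id) with hN
  have hM : Matrix.fromBlocks ((1 + c) • X₁) (c • X₂) (c • X₁.submatrix π id) (c • X₂.submatrix π id) =
      Matrix.fromBlocks (1 : Matrix (Fin rD) (Fin rD) ℂ) 0 0 (c • (1 : Matrix (Fin rL) (Fin rL) ℂ)) * N := by
    rw [hN, Matrix.fromBlocks_multiply]
    simp [Matrix.smul_mul]
  -- E · N is block upper triangular, E = fromBlocks 1 0 (−P) ((1+c)•1)
  set E : Matrix (Fin rD ⊕ Fin rL) (Fin rD ⊕ Fin rL) ℂ :=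
    Matrix.fromBlocks (1 : Matrix (Fin rD) (Fin rD) ℂ) 0 (-P) ((1 + c) • (1 : Matrix (Fin rL) (Fin rL) ℂ)) with hE
  have hEN : E * N = Matrix.fromBlocks ((1 + c) • X₁) (c • X₂) 0 (X₂.submatrix π id) := by
    rw [hE, hN, Matrix.fromBlocks_multiply]
    congr 1
    · simp
    · simp
    · rw [Matrix.neg_mul, Matrix.smul_mul, Matrix.one_mul, Matrix.mul_smul, hPX X₁]
      simp
    · rw [Matrix.neg_mul, Matrix.smul_mul, Matrix.one_mul, Matrix.mul_smul, hPX X₂]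
      ext ℓ j
      simp only [Matrix.add_apply, Matrix.neg_apply, Matrix.smul_apply, smul_eq_mul]
      ring
  have hdetE : E.det = (1 + c) ^ rL := by
    rw [hE, Matrix.det_fromBlocks_zero₁₂, Matrix.det_one, one_mul, Matrix.det_smul, Matrix.det_one, mul_one,
      Fintype.card_fin]
  have hdetEN : (E * N).det = ((1 + c) • X₁).det * (X₂.submatrix π id).det := by
    rw [hEN, Matrix.det_fromBlocks_zero₂₁]
  rw [Matrix.det_mul, hdetE, Matrix.det_smul, Fintype.card_fin] at hdetEN
  have hdetM : (Matrix.fromBlocks ((1 + c) • X₁) (c • X₂) (c • X₁.submatrix π id) (c • X₂.submatrix π id)).det =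
      c ^ rL * N.det := by
    rw [hM, Matrix.det_mul, Matrix.det_fromBlocks_zero₂₁, Matrix.det_one, one_mul, Matrix.det_smul, Matrix.det_one,
      mul_one, Fintype.card_fin]
  rw [hdetM]
  calc (1 + c) ^ rL * (c ^ rL * N.det) = c ^ rL * ((1 + c) ^ rL * N.det) := by ring
    _ = c ^ rL * ((1 + c) ^ rD * X₁.det * (X₂.submatrix π id).det) := by rw [hdetEN]
    _ = c ^ rL * (1 + c) ^ rD * X₁.det * (X₂.submatrix π id).det := by ring

/-- **THE EQUAL-LINK CUT (determinant form).** Under the hypotheses of `fullJoin_submatrix_cut`: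
`(1+λ_k)^{rL} · det(M.submatrix eRow eCol) = λ_k^{rL} (1+λ_k)^{rD} · det X[D,D'] · det X[L,L']`, where `X[L,L']` is the full hidden sum
over `S'` on the link families `u ∖ a`, `w ∖ b` (written through `π` on the `u` side). -/
theorem det_fullJoin_cut (S' : Finset (Fin K)) (k : Fin K) (hk : k ∉ S') (a b : Fin h)
    (u w : Fin r → Finset (Fin h)) (tx ty : Option (Fin K) → Fin h → ℂ) (lam : Fin K → ℂ)
    (hxa0 : tx none a = 0) (hxk : tx (some k) a = 1) (hxq : ∀ q, q ≠ k → tx (some q) a = 0)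
    (hxk' : ∀ a', a' ≠ a → tx (some k) a' = 0)
    (hyb0 : ty none b = 0) (hyk : ty (some k) b = 1) (hyq : ∀ q, q ≠ k → ty (some q) b = 0)
    (hyk' : ∀ b', b' ≠ b → ty (some k) b' = 0)
    (eRow eCol : Fin rD ⊕ Fin rL ≃ Fin r)
    (hDrow : ∀ i, a ∉ u (eRow (Sum.inl i))) (hLrow : ∀ ℓ, a ∈ u (eRow (Sum.inr ℓ)))
    (hDcol : ∀ j, b ∉ w (eCol (Sum.inl j))) (hLcol : ∀ ℓ, b ∈ w (eCol (Sum.inr ℓ)))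
    (π : Fin rL → Fin rD) (hπ : ∀ ℓ, u (eRow (Sum.inl (π ℓ))) = (u (eRow (Sum.inr ℓ))).erase a) :
    (1 + lam k) ^ rL *
      ((Matrix.of fun i j : Fin r => ∑ J ∈ (insert k S').powerset, (∏ q ∈ J, lam q) *
        ((∏ a' ∈ u i, (tx none a' + ∑ q ∈ J, tx (some q) a')) *
          ∏ c ∈ w j, (ty none c + ∑ q ∈ J, ty (some q) c))).submatrix eRow eCol).det =
      lam k ^ rL * (1 + lam k) ^ rD *
        (Matrix.of fun i j : Fin rD => ∑ J ∈ S'.powerset, (∏ q ∈ J, lam q) *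
          ((∏ a' ∈ u (eRow (Sum.inl i)), (tx none a' + ∑ q ∈ J, tx (some q) a')) *
            ∏ c ∈ w (eCol (Sum.inl j)), (ty none c + ∑ q ∈ J, ty (some q) c))).det *
        (Matrix.of fun ℓ ℓ' : Fin rL => ∑ J ∈ S'.powerset, (∏ q ∈ J, lam q) *
          ((∏ a' ∈ (u (eRow (Sum.inr ℓ))).erase a, (tx none a' + ∑ q ∈ J, tx (some q) a')) *
            ∏ c ∈ (w (eCol (Sum.inr ℓ'))).erase b, (ty none c + ∑ q ∈ J, ty (some q) c))).det := by
  classical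
  rw [fullJoin_submatrix_cut S' k hk a b u w tx ty lam hxa0 hxk hxq hxk' hyb0 hyk hyq hyk' eRow eCol hDrow hLrow hDcol hLcol π hπ,
    det_fromBlocks_cut]
  congr 2
  refine Matrix.ext fun ℓ ℓ' => ?_
  rw [Matrix.submatrix_apply, Matrix.of_apply, Matrix.of_apply, hπ ℓ]
  rfl

/-- **THE EQUAL-LINK STEP for conjecture FJ.** Under the same hypotheses, if the deletion block and the link block of the full hidden sum
over `S'` are nonsingular AT THE SAME TABLE, and `λ_k ≠ 0`, `1 + λ_k ≠ 0`, then the full hidden sum over `insert k S'` on `(u, w)` is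
nonsingular. (Reindexing by the two equivalences changes the determinant by a sign only.) -/
theorem det_fullJoin_cut_ne_zero (S' : Finset (Fin K)) (k : Fin K) (hk : k ∉ S') (a b : Fin h)
    (u w : Fin r → Finset (Fin h)) (tx ty : Option (Fin K) → Fin h → ℂ) (lam : Fin K → ℂ)
    (hxa0 : tx none a = 0) (hxk : tx (some k) a = 1) (hxq : ∀ q, q ≠ k → tx (some q) a = 0)
    (hxk' : ∀ a', a' ≠ a → tx (some k) a' = 0)
    (hyb0 : ty none b = 0) (hyk : ty (some k) b = 1) (hyq : ∀ q, q ≠ k → ty (some q) b = 0)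
    (hyk' : ∀ b', b' ≠ b → ty (some k) b' = 0)
    (eRow eCol : Fin rD ⊕ Fin rL ≃ Fin r)
    (hDrow : ∀ i, a ∉ u (eRow (Sum.inl i))) (hLrow : ∀ ℓ, a ∈ u (eRow (Sum.inr ℓ)))
    (hDcol : ∀ j, b ∉ w (eCol (Sum.inl j))) (hLcol : ∀ ℓ, b ∈ w (eCol (Sum.inr ℓ)))
    (π : Fin rL → Fin rD) (hπ : ∀ ℓ, u (eRow (Sum.inl (π ℓ))) = (u (eRow (Sum.inr ℓ))).erase a)
    (hlam0 : lam k ≠ 0) (hlam1 : 1 + lam k ≠ 0)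
    (hdetD : (Matrix.of fun i j : Fin rD => ∑ J ∈ S'.powerset, (∏ q ∈ J, lam q) *
          ((∏ a' ∈ u (eRow (Sum.inl i)), (tx none a' + ∑ q ∈ J, tx (some q) a')) *
            ∏ c ∈ w (eCol (Sum.inl j)), (ty none c + ∑ q ∈ J, ty (some q) c))).det ≠ 0)
    (hdetL : (Matrix.of fun ℓ ℓ' : Fin rL => ∑ J ∈ S'.powerset, (∏ q ∈ J, lam q) *
          ((∏ a' ∈ (u (eRow (Sum.inr ℓ))).erase a, (tx none a' + ∑ q ∈ J, tx (some q) a')) *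
            ∏ c ∈ (w (eCol (Sum.inr ℓ'))).erase b, (ty none c + ∑ q ∈ J, ty (some q) c))).det ≠ 0) :
    (Matrix.of fun i j : Fin r => ∑ J ∈ (insert k S').powerset, (∏ q ∈ J, lam q) *
        ((∏ a' ∈ u i, (tx none a' + ∑ q ∈ J, tx (some q) a')) *
          ∏ c ∈ w j, (ty none c + ∑ q ∈ J, ty (some q) c))).det ≠ 0 := by
  classical
  set M : Matrix (Fin r) (Fin r) ℂ := Matrix.of fun i j : Fin r => ∑ J ∈ (insert k S').powerset, (∏ q ∈ J, lam q) *
        ((∏ a' ∈ u i, (tx none a' + ∑ q ∈ J, tx (some q) a')) *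
          ∏ c ∈ w j, (ty none c + ∑ q ∈ J, ty (some q) c)) with hM
  have hcut := det_fullJoin_cut S' k hk a b u w tx ty lam hxa0 hxk hxq hxk' hyb0 hyk hyq hyk' eRow eCol hDrow hLrow hDcol hLcol π hπ
  rw [← hM] at hcut
  -- the reindexed determinant is nonzero
  have hsub : (M.submatrix eRow eCol).det ≠ 0 := by
    intro h0
    rw [h0, mul_zero] at hcut
    exact (mul_ne_zero (mul_ne_zero (mul_ne_zero (pow_ne_zero _ hlam0) (pow_ne_zero _ hlam1)) hdetD) hdetL) hcut.symm
  -- relate to `det M` through a permutation of `Fin r`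
  have hperm : M.submatrix eRow eCol = (M.submatrix id (eRow.symm.trans eCol : Equiv.Perm (Fin r))).submatrix eRow eRow := by
    ext x y
    simp [Matrix.submatrix_apply]
  rw [hperm, Matrix.det_submatrix_equiv_self, Matrix.det_permute'] at hsub
  intro h0
  exact hsub (by rw [h0, mul_zero])

end FullJoin

end

end Summit.ValiantsHypothesis.ValiantsHypothesis.Theorems.BarrierLever.HiddenStates
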